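import Summits.QuantumFields.BalabanUV.Beta.D1BFx.KernelWardInsertion

/-!
# `BalabanUV.Beta.D1BFx.KernelWardInsertionZero` — road «BF-x» for binder row D1, slot (K), census groups G_Λ ∕ NEEDLES, FINDING F-g9-1: **THE ZERO-MOMENTUM
# FORM OF `ward_insertion`** — under (W1)∕(W2′) the summed response of an insertion tadpole over ALL background bonds of a given direction VANISHES:
# `Σ'_y (½·tadpole A (Z α y) − ½·bubble A (V α y) Y) = 0` (letter (III) of the G_Λ row: `Σ_X N̄_X + seagull = 0`, on `ℤ^D`, for blocking `N ≥ 1`)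

HONEST DEPENDENCY (cell records, verbatim): «continuum YM on T⁴ ⇐ BetaPertH ∧ nine spine estimates (0/9 proved); BetaPertH ⇐ (D1) ∧ (D4) ∧
CAP+tail; G-an2-4 gates asym, D1 and NE2/3/4.»  HONEST FRAMING (cell contract, verbatim): «discharging `BetaPertH` makes Bałaban's UV stability
UNCONDITIONAL — a real constructive-QFT result; it is NOT the continuum limit and NOT the Clay problem.»  THIS MODULE DISCHARGES NOTHING of (K),
of D1 or of the wall: [folklore] composition BY NAME of `KernelWardInsertion.ward_insertion` (transversality), `ExpKernelCalculus.abs_tadpole_le` ∕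
`abs_bubble_le` (decay of the response in the bond position) and `PolarizationSign.tsum_eq_zero_of_ward` (summation by parts).  No definition, no
`def … : Prop`, nothing cited, no wall binder instantiated, 0 sorry.  (W1)∕(W2′) for the typed objects stay DISPLAYED.  NOT D1, NOT BetaPertH, NOT continuum, NOT Clay.

ABSOLUTE RULE (cell charter, verbatim): «No internally-minted statement may enter as a cited fact. Every hypothesis is either kernel-proved in this
package or a verbatim quotation of a PUBLISHED theorem with page reference. The manuscript(s) under audit are NOT citable for their own disputed
steps — they are the thing under adjudication; programme-internal (2001/route/tribunal) claims are never citable.»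

Unit `b2b-balaban-beta-d1-p2` (road owner, gen 9); `K-CLOSURE-PLAN-R1L.md` §6.
-/

open Finset
open scoped BigOperators
open Literature.MathematicalPhysics.QuantumFieldTheory.Balaban1983to89
open Literature.MathematicalPhysics.QuantumFieldTheory.Balaban1983to89.Beta
open B12Sec2to5 (l1 l1_nonneg summable_exp_neg_l1)
open B6BondElimination (unitVec unitVec_apply)
open ExpKernelCalculus (Decays BiLoc comp tr bubble tadpole VertexFamily Zl l1_natSmul l1_sub_triangle abs_tadpole_le abs_bubble_le)
open KernelWard (divV)
open PolarizationSign (size MomentSummable WardTransversal tsum_eq_zero_of_ward one_add_pow_mul_exp_neg_le)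
open Summit.QuantumFields.BalabanUV.Beta.D1BFx.KernelWardInsertion (ward_insertion)

namespace Summit.QuantumFields.BalabanUV.Beta.D1BFx.KernelWardInsertionZero

noncomputable section

variable {D : ℕ} {F : Type*} [Fintype F]

/-- [folklore] For `N ≥ 1`: `|y|₁ ≤ |N•y − Q|₁ + |Q|₁`. -/
theorem l1_le_natSmul_sub_add {N : ℕ} (hN : 1 ≤ N) (y Q : Fin D → ℤ) : l1 y ≤ l1 ((N : ℤ) • y - Q) + l1 Q := by
  have h1 : l1 ((N : ℤ) • y - 0) ≤ l1 ((N : ℤ) • y - Q) + l1 (Q - 0) := l1_sub_triangle _ _ _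
  rw [sub_zero, sub_zero, l1_natSmul] at h1
  have : (1 : ℝ) ≤ (N : ℝ) := by exact_mod_cast hN
  nlinarith [l1_nonneg y]

/-- [folklore] Summability of the cubic-moment majorant shifted to the coarse bonds: `Σ_y e^{−c|N•y − Q|₁}·size(y)³ < ∞` (`c > 0`, `N ≥ 1`). -/
theorem summable_exp_natSmul_sub_mul_size_pow {c : ℝ} (hc : 0 < c) {N : ℕ} (hN : 1 ≤ N) (Q : Fin D → ℤ) :
    Summable fun y : Fin D → ℤ => Real.exp (-c * l1 ((N : ℤ) • y - Q)) * size y ^ 3 := by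
  set K : ℝ := ((3 : ℕ).factorial : ℝ) * Real.exp (c / 2) / (c / 2) ^ 3 with hK
  refine Summable.of_nonneg_of_le (fun y => mul_nonneg (Real.exp_pos _).le (pow_nonneg (PolarizationSign.size_pos y).le 3))
    (fun y => ?_) ((summable_exp_neg_l1 (half_pos hc) D).mul_left (Real.exp (c * l1 Q) * K))
  have h1 := l1_le_natSmul_sub_add hN y Q
  have h2 : Real.exp (-c * l1 ((N : ℤ) • y - Q)) ≤ Real.exp (c * l1 Q) * Real.exp (-c * l1 y) := by
    rw [← Real.exp_add]; exact Real.exp_le_exp.mpr (by nlinarith)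
  have h3 : size y ^ 3 * Real.exp (-c * l1 y) ≤ K * Real.exp (-(c / 2) * l1 y) := by
    have := one_add_pow_mul_exp_neg_le hc 3 (l1_nonneg y)
    simpa only [PolarizationSign.size_eq_one_add_l1] using this
  calc Real.exp (-c * l1 ((N : ℤ) • y - Q)) * size y ^ 3 ≤ (Real.exp (c * l1 Q) * Real.exp (-c * l1 y)) * size y ^ 3 :=
        mul_le_mul_of_nonneg_right h2 (pow_nonneg (PolarizationSign.size_pos y).le 3)
    _ = Real.exp (c * l1 Q) * (size y ^ 3 * Real.exp (-c * l1 y)) := by ring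
    _ ≤ Real.exp (c * l1 Q) * (K * Real.exp (-(c / 2) * l1 y)) := mul_le_mul_of_nonneg_left h3 (Real.exp_pos _).le
    _ = Real.exp (c * l1 Q) * K * Real.exp (-(c / 2) * l1 y) := by ring

/-- [folklore] **THE ZERO-MOMENTUM WARD LETTER FOR AN INSERTION** (FINDING F-g9-1's letter (III) on `ℤ^D`): under the hypotheses of
`KernelWardInsertion.ward_insertion` and `N ≥ 1`, the response of the insertion tadpole summed over ALL background bonds of direction `α` VANISHES:
`Σ'_y (½·tadpole A (Z α y) − ½·bubble A (V α y) Y) = 0`.  Proof: transversality (`ward_insertion`) + decay of the response in the bond position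
(`abs_tadpole_le`, `abs_bubble_le`) ⇒ `MomentSummable · 3` ⇒ summation by parts `PolarizationSign.tsum_eq_zero_of_ward`. -/
theorem tsum_resp_eq_zero {A : ExpKernelCalculus.MKer D F} {V Z : Fin D → (Fin D → ℤ) → ExpKernelCalculus.MKer D F}
    {Y : ExpKernelCalculus.MKer D F} {C Cv Cz Cy Cx δ : ℝ} {N : ℕ} {Q : Fin D → ℤ}
    (X : (Fin D → ℤ) → ExpKernelCalculus.MKer D F) (hN : 1 ≤ N)
    (hA : Decays A C δ) (hV : VertexFamily V N Cv δ) (hZ : ∀ μ y, BiLoc (Z μ y) ((N : ℤ) • y) Q Cz δ) (hY : BiLoc Y Q Q Cy δ)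
    (hX : ∀ y, BiLoc (X y) ((N : ℤ) • y) ((N : ℤ) • y) Cx δ) (hδ : 0 < δ)
    (hW1 : ∀ y, comp (comp A (divV V y)) A = comp A (X y) - comp (X y) A)
    (hW2 : ∀ y, divV Z y = comp (X y) Y - comp Y (X y))
    (α : Fin D) :
    ∑' y : Fin D → ℤ, ((1 / 2 : ℝ) * tadpole A (Z α y) - (1 / 2) * bubble A (V α y) Y) = 0 := by
  classical
  -- the response as a (ν-independent) kernel on the bond lattice
  set P : B12Beta.Kernel D := fun μ _ y => (1 / 2 : ℝ) * tadpole A (Z μ y) - (1 / 2) * bubble A (V μ y) Y with hP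
  have hT : WardTransversal P := fun ν z => by
    simp only [hP]
    exact ward_insertion X hA hV hZ hY hX hδ hW1 hW2 z
  -- decay in the bond position ⇒ cubic-moment summability
  set Kt := (Fintype.card F : ℝ) * ((Fintype.card F : ℝ) * (C * Cz) * Zl D (δ - δ / 2)) * Zl D (δ / 2 / 2) with hKt
  set Kb := (Fintype.card F : ℝ) * ((Fintype.card F : ℝ) * (((Fintype.card F : ℝ) * (C * Cv) * Zl D (δ - δ / 2)) *
            ((Fintype.card F : ℝ) * (C * Cy) * Zl D (δ - δ / 2))) * Zl D (δ / 2 / 2)) * Zl D (δ / 2 / 2) with hKb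
  have hδ4 : 0 < δ / 2 / 2 := by positivity
  have hM : MomentSummable P 3 := by
    intro μ ν
    have hmaj : Summable fun y : Fin D → ℤ =>
        ((1 / 2) * Kt) * (Real.exp (-(δ / 2 / 2) * l1 ((N : ℤ) • y - Q)) * size y ^ 3)
          + ((1 / 2) * Kb) * (Real.exp (-(δ / 2 / 2 + δ / 2 / 2) * l1 ((N : ℤ) • y - Q)) * size y ^ 3) :=
      ((summable_exp_natSmul_sub_mul_size_pow hδ4 hN Q).mul_left _).add
        ((summable_exp_natSmul_sub_mul_size_pow (by positivity) hN Q).mul_left _)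
    refine Summable.of_nonneg_of_le (fun y => mul_nonneg (abs_nonneg _) (pow_nonneg (PolarizationSign.size_pos y).le 3)) (fun y => ?_) hmaj
    have ht := abs_tadpole_le hA (hZ μ y) hδ
    have hb := abs_bubble_le hA (hV μ y) hY hδ
    rw [← hKt] at ht
    have hb' : |bubble A (V μ y) Y| ≤ Kb * Real.exp (-(δ / 2 / 2 + δ / 2 / 2) * l1 ((N : ℤ) • y - Q)) := by
      refine hb.trans (le_of_eq ?_)
      rw [hKb, show -(δ / 2 / 2 + δ / 2 / 2) * l1 ((N : ℤ) • y - Q) = -(δ / 2 / 2) * l1 ((N : ℤ) • y - Q) + -(δ / 2 / 2) * l1 ((N : ℤ) • y - Q) by ring,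
        Real.exp_add]
      ring
    have hs : 0 ≤ size y ^ 3 := pow_nonneg (PolarizationSign.size_pos y).le 3
    simp only [hP]
    calc |(1 / 2 : ℝ) * tadpole A (Z μ y) - (1 / 2) * bubble A (V μ y) Y| * size y ^ 3
        ≤ ((1 / 2) * |tadpole A (Z μ y)| + (1 / 2) * |bubble A (V μ y) Y|) * size y ^ 3 := by
          refine mul_le_mul_of_nonneg_right ?_ hs
          calc |(1 / 2 : ℝ) * tadpole A (Z μ y) - (1 / 2) * bubble A (V μ y) Y|
              ≤ |(1 / 2 : ℝ) * tadpole A (Z μ y)| + |(1 / 2 : ℝ) * bubble A (V μ y) Y| := abs_sub _ _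
            _ = (1 / 2) * |tadpole A (Z μ y)| + (1 / 2) * |bubble A (V μ y) Y| := by
                rw [abs_mul, abs_mul, abs_of_pos (by norm_num : (0 : ℝ) < 1 / 2)]
      _ ≤ ((1 / 2) * (Kt * Real.exp (-(δ / 2 / 2) * l1 ((N : ℤ) • y - Q)))
            + (1 / 2) * (Kb * Real.exp (-(δ / 2 / 2 + δ / 2 / 2) * l1 ((N : ℤ) • y - Q)))) * size y ^ 3 := by
          refine mul_le_mul_of_nonneg_right ?_ hs
          linarith
      _ = ((1 / 2) * Kt) * (Real.exp (-(δ / 2 / 2) * l1 ((N : ℤ) • y - Q)) * size y ^ 3)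
          + ((1 / 2) * Kb) * (Real.exp (-(δ / 2 / 2 + δ / 2 / 2) * l1 ((N : ℤ) • y - Q)) * size y ^ 3) := by ring
  have h := tsum_eq_zero_of_ward hM hT α α
  simpa only [hP] using h

end

end Summit.QuantumFields.BalabanUV.Beta.D1BFx.KernelWardInsertionZero
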